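import Summits.CriticalPhenomena.Ising3DConformalLimit.Theses.SubPtolemyInterlacing
import HarnessLib

/-!
# `SubPtolemyInterlacing.Assembly` (item stmt-CriticalPhenomena-15707), proved

THEOREM-ONLY file (no definitions, no named facts). The assembly item of route
`SubPtolemyInterlacing` of the sub-problem `Ising3DConformalLimit`:

`Interlacing → SubPtolemyFloor → MoebiusLimit → InterlacingForcesU4 → Ising3DConformalLimit`.

Proof (pure logic, the route's own deciding theorem `closes`): take the witness `(ρ, Δ, S)` of
`MoebiusLimit`; clauses (i), (ii) of `Ising3DConformalLimit` are the witness data, and clause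
(iii) `HasNontrivialU4 S` is `InterlacingForcesU4` fed `Interlacing`, `SubPtolemyFloor`, the
limit data, and translation invariance / scale covariance read off Möbius covariance
(`IsMoebiusCovariant = (IsEuclideanInvariant ∧ …) ∧ IsScaleCovariant ∧ …`, projections `.1.1`
and `.2.1`).

No literature input beyond the definitions of
`Literature/Probability/LatticeModels/ConformalCovariance.lean`.
-/

namespace Summit.CriticalPhenomena.Ising3DConformalLimit.Theorems

open Literature.Probability.LatticeModels
open Summit.CriticalPhenomena.Ising3DConformalLimit.Theses

/-- **`Assembly` (item stmt-CriticalPhenomena-15707 of route `SubPtolemyInterlacing`), proved**: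
`Interlacing → SubPtolemyFloor → MoebiusLimit → InterlacingForcesU4 → Ising3DConformalLimit`.
Take the Möbius-covariant non-degenerate pointwise limit `(ρ, Δ, S)` of `MoebiusLimit`; clause
(iii) `HasNontrivialU4 S` is `InterlacingForcesU4` applied to `Interlacing`, `SubPtolemyFloor`,
the limit data and the translation-invariance / scale-covariance components of
`IsMoebiusCovariant Δ S`. Settles item stmt-CriticalPhenomena-15707 (exact signature); the term is
the route's deciding theorem `SubPtolemyInterlacing.closes`. [folklore] -/
theorem subPtolemyInterlacing_assembly_proof : SubPtolemyInterlacing.Assembly := by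
  unfold SubPtolemyInterlacing.Assembly
  intro hI hF hML hU
  -- (ML): the Möbius-covariant, non-degenerate pointwise limit (ρ, Δ, S)
  obtain ⟨ρ, Δ, S, hρ, hΔ, hlim, hnd, hmob⟩ := hML
  -- clause (iii) from InterlacingForcesU4, translation invariance = hmob.1.1, scale covariance = hmob.2.1
  exact ⟨ρ, Δ, S, hρ, hΔ, hlim, hnd, hmob, hU hI hF ρ Δ S hρ hlim hnd hmob.1.1 hmob.2.1⟩

end Summit.CriticalPhenomena.Ising3DConformalLimit.Theorems
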